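import Summits.MatrixMultiplication.OmegaCensus.STPPVosperCoverEK1G1
import Summits.MatrixMultiplication.OmegaCensus.STPPVosperCoverEK1G2
import Summits.MatrixMultiplication.OmegaCensus.STPPVosperCoverEK1G3
import Summits.MatrixMultiplication.OmegaCensus.STPPVosperCoverEK1G4
import Summits.MatrixMultiplication.OmegaCensus.STPPVosperCoverEK1G5
/-!
# ω-census (abelian STPP census): K1 `{(1,1,2),(2,2,3),(3,4,2)²} ⊄ ℤ₆₁` — case γ assembly (kernel computations)

HONEST FRAMING (pub-omega census; verbatim): lottery ticket; floor = certified bounds/negative ranges.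
Census STRUCTURE (seat pub-omega-stpp-1 gen 32, 2026-08-28), family (b2).  Rows for the kill `STPPVosperCoverKillK1Z61.lean` by the law
`no_isSTPP_of_slack_one_coverE_prime_a2` (`STPPVosperSlackOneCoverLawA2E.lean`) with the pruned enumerator `blockDiffsWP` (`STPPVosperTilingWordsPruned.lean`):
reading `(a,b,c) = (2,3,4)` of the leaf (family `(C, A, B)`, block `3`; `(n+1, L, b, z) = (43, 17, 3, 16)`; other blocks `(2,3,4), (3,2,2), (2,1,1)`, Y-first).
Assembles the 34 case-γ rows into the two `∀ ν` statements used by the kill file.  Each theorem is ONE `existsCoverW … = false` decided by the kernel (python mirror HOME `pub-omega-stpp-1-g32/code/k1_gen.py`: ≤ 6.1·10⁴ steps each).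
Nothing here is progress on `ω`.
-/

namespace Summit.MatrixMultiplication.OmegaCensus.CubeNB

/-- Case γ, `j = 30`: the search fails for every missing index `ν ≤ 16`. [folklore] -/
theorem ceK1_g_j30 : ∀ ν < 16 + 1, existsCoverW 61 ((List.range 17).map fun t => (30 * t) % 61) ((List.range (16 + 1)).filter fun t => decide (t ≠ ν))
    ([((2 : ℕ), (3 : ℕ), (4 : ℕ)), (3, 2, 2), (2, 1, 1)].map fun s => blockDiffsWP 61 ((List.range 17).map fun t => (30 * t) % 61) ((List.range (16 + 1)).filter fun t => decide (t ≠ ν)) s.1 s.2.1 s.2.2) [] [] [] = false := by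
  intro ν hν
  interval_cases ν
  · exact ceK1_g_j30_n0
  · exact ceK1_g_j30_n1
  · exact ceK1_g_j30_n2
  · exact ceK1_g_j30_n3
  · exact ceK1_g_j30_n4
  · exact ceK1_g_j30_n5
  · exact ceK1_g_j30_n6
  · exact ceK1_g_j30_n7
  · exact ceK1_g_j30_n8
  · exact ceK1_g_j30_n9
  · exact ceK1_g_j30_n10
  · exact ceK1_g_j30_n11
  · exact ceK1_g_j30_n12
  · exact ceK1_g_j30_n13
  · exact ceK1_g_j30_n14
  · exact ceK1_g_j30_n15
  · exact ceK1_g_j30_n16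

/-- Case γ, `j = 31`: the search fails for every missing index `ν ≤ 16`. [folklore] -/
theorem ceK1_g_j31 : ∀ ν < 16 + 1, existsCoverW 61 ((List.range 17).map fun t => (31 * t) % 61) ((List.range (16 + 1)).filter fun t => decide (t ≠ ν))
    ([((2 : ℕ), (3 : ℕ), (4 : ℕ)), (3, 2, 2), (2, 1, 1)].map fun s => blockDiffsWP 61 ((List.range 17).map fun t => (31 * t) % 61) ((List.range (16 + 1)).filter fun t => decide (t ≠ ν)) s.1 s.2.1 s.2.2) [] [] [] = false := by
  intro ν hν
  interval_cases ν
  · exact ceK1_g_j31_n0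
  · exact ceK1_g_j31_n1
  · exact ceK1_g_j31_n2
  · exact ceK1_g_j31_n3
  · exact ceK1_g_j31_n4
  · exact ceK1_g_j31_n5
  · exact ceK1_g_j31_n6
  · exact ceK1_g_j31_n7
  · exact ceK1_g_j31_n8
  · exact ceK1_g_j31_n9
  · exact ceK1_g_j31_n10
  · exact ceK1_g_j31_n11
  · exact ceK1_g_j31_n12
  · exact ceK1_g_j31_n13
  · exact ceK1_g_j31_n14
  · exact ceK1_g_j31_n15
  · exact ceK1_g_j31_n16


end Summit.MatrixMultiplication.OmegaCensus.CubeNB
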